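import Summits.MatrixMultiplication.MatrixMultiplication.Theorems.SaturationLadderTwinFamily
import HarnessLib

/-!
# SaturationLadder — twin rung, STAGE-2 family: the `X`-inequality holds; only `Y` remains

Route `SaturationLadder` (sub-problem `MatrixMultiplication`), aside `TwinSaturation`
(stmt-MatrixMultiplication-30539).  `Theorems/SaturationLadderTwinFamily.lean` reduced the rung to two
entropy inequalities along the family `(n₁,…,n₆) = (30j+20, 20j·2^{j+1} − 30j − 37, 30j+37, 10j−20,
0, 20j)`, `j ≥ 64`.  Here the first one is PROVED:

* `familyX`: `H(Z_j) ≤ H(X_j)` for all `j ≥ 64`, where `Z_j = (2, 2^{j+1}, 1)/d` (`d = 2^{j+1} + 3`)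
  and `X_j = (1 − σ/d, σ/d, 0)`, `σ = 3 + 57/(20 j)`.  In nats the left side is
  `log(d/2^{j+1}) + (3j+1) log 2 / d ≤ 3/2^{j+1} + (3j+1) log 2 / d`, the right side is
  `≥ (σ/d)(log d − log σ) + σ/d − σ²/d²`, and `d ×` the difference is at least
  `(97/20 + ε) log 2 − (3 + ε) log 3 − ε²/3 − 19/2^{j+1} ≥ 0.027` (`ε = 57/(20j) ≤ 57/1280`,
  `log 3 ≤ 1.10505` from the Taylor remainder of `log(1 − 1/4)`).
* `twinSaturation_of_familyY`: consequently `TwinSaturation` follows from the `Y`-inequality ALONE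
  (for all `j ≥ j₀`, any `j₀ ≥ 64` — a larger `j₀` buys slack: numerically
  `d · (H(Y_j) − H(Z_j)) · log 2 ≈ 0.031 − 1.80/j`).

No named facts, no sorry (cell `decomp-mm`, lens 1, gen 8).
-/

set_option linter.dupNamespace false
-- (single-conjunct summit: the namespace repeats `MatrixMultiplication`)

noncomputable section

namespace Summit.MatrixMultiplication.MatrixMultiplication.Theorems.SaturationLadderTwinFamilyX

open Literature.Computability.AlgebraicComplexity
open Summit.MatrixMultiplication.MatrixMultiplication.Theses.SaturationLadder (TwinSaturation)
open Summit.MatrixMultiplication.MatrixMultiplication.Theorems.SaturationLadderTwinExact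
  (omegaRect_one_tw_exact)
open Summit.MatrixMultiplication.MatrixMultiplication.Theorems.SaturationLadderTwinReduction
  (twinSaturation_of_certificates)
open Summit.MatrixMultiplication.MatrixMultiplication.Theorems.SaturationLadderTwinFamily

/-! ## A numerical bound for `log 3` -/

/-- `log 3 ≤ 1.10505` (`log 3 = 2 log 2 + log(1 − 1/4)`, three Taylor terms). [folklore] -/
theorem log_three_le : Real.log 3 ≤ 1.10505 := by
  have h := Real.abs_log_sub_add_sum_range_le (x := (1 / 4 : ℝ))
    (by rw [abs_of_pos (by norm_num)]; norm_num) 3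
  rw [abs_le] at h
  have h2 := h.2
  simp only [Finset.sum_range_succ, Finset.sum_range_zero] at h2
  norm_num [abs_of_pos] at h2
  have e : Real.log 3 = 2 * Real.log 2 + Real.log (3 / 4) := by
    have : (3 : ℝ) = 2 ^ 2 * (3 / 4) := by norm_num
    conv_lhs => rw [this]
    rw [Real.log_mul (by norm_num) (by norm_num), Real.log_pow]; push_cast; ring
  have hl2 := Real.log_two_lt_d9
  rw [e]; linarith

/-! ## The `X`-inequality along the family -/

set_option maxHeartbeats 800000 in
/-- **`H(Z_j) ≤ H(X_j)` for the STAGE-2 family, all `j ≥ 64`.**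
[cite: CoppersmithWinograd1990, §8] [cite: AlmanDuanVassilevskaWilliamsXuXuZhou2025, §3.4] -/
theorem familyX (j : ℕ) (hj : 64 ≤ j) :
    shannonEntropy
        ![((fN₁ j : ℝ) + fN₄ j + (0 : ℕ)) / (fN₁ j + fN₂ j + fN₃ j + fN₄ j + 0 + fN₆ j : ℕ),
        ((fN₂ j : ℝ) + fN₃ j) / (fN₁ j + fN₂ j + fN₃ j + fN₄ j + 0 + fN₆ j : ℕ),
        (fN₆ j : ℝ) / (fN₁ j + fN₂ j + fN₃ j + fN₄ j + 0 + fN₆ j : ℕ)] ≤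
      shannonEntropy
        ![((fN₂ j : ℝ) + fN₄ j + fN₆ j) / (fN₁ j + fN₂ j + fN₃ j + fN₄ j + 0 + fN₆ j : ℕ),
        ((fN₁ j : ℝ) + fN₃ j) / (fN₁ j + fN₂ j + fN₃ j + fN₄ j + 0 + fN₆ j : ℕ),
        ((0 : ℕ) : ℝ) / (fN₁ j + fN₂ j + fN₃ j + fN₄ j + 0 + fN₆ j : ℕ)] := by
  -- real abbreviations
  have hJ : (64 : ℝ) ≤ (j : ℝ) := by exact_mod_cast hj
  have hB1 : (2 : ℝ) ^ 65 ≤ (2 : ℝ) ^ (j + 1) := pow_le_pow_right₀ (by norm_num) (by omega)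
  have hBpos : (0 : ℝ) < (2 : ℝ) ^ (j + 1) := by positivity
  set B : ℝ := (2 : ℝ) ^ (j + 1) with hBdef
  set d : ℝ := B + 3 with hddef
  have hdpos : 0 < d := by positivity
  have hBd : B ≤ d := by linarith
  -- the counts as reals
  have c₁ : ((fN₁ j : ℕ) : ℝ) = 30 * j + 20 := by unfold fN₁; push_cast; ring
  have c₂ : ((fN₂ j : ℕ) : ℝ) = 20 * j * B - (30 * j + 37) := by
    rw [fN₂_cast j (by omega)]
  have c₃ : ((fN₃ j : ℕ) : ℝ) = 30 * j + 37 := by unfold fN₃; push_cast; ring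
  have c₄ : ((fN₄ j : ℕ) : ℝ) = 10 * j - 20 := fN₄_cast j (by omega)
  have c₆ : ((fN₆ j : ℕ) : ℝ) = 20 * j := by unfold fN₆; push_cast; ring
  have cN : ((fN₁ j + fN₂ j + fN₃ j + fN₄ j + 0 + fN₆ j : ℕ) : ℝ) = 20 * j * d := by
    push_cast; rw [c₁, c₂, c₃, c₄, c₆, hddef]; ring
  have hNpos : (0 : ℝ) < 20 * j * d := by positivity
  -- the entries: `Z = (2, B, 1)/d`, `X = (1 − σ/d, σ/d, 0)` with `σ = 3 + 57/(20 j)`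
  set σ : ℝ := 3 + 57 / (20 * j) with hσdef
  have hjpos : (0 : ℝ) < j := by linarith
  have eZ0 : ((fN₁ j : ℝ) + fN₄ j + (0 : ℕ)) / (fN₁ j + fN₂ j + fN₃ j + fN₄ j + 0 + fN₆ j : ℕ) =
      2 / d := by
    rw [cN, c₁, c₄]; push_cast; field_simp; ring
  have eZ1 : ((fN₂ j : ℝ) + fN₃ j) / (fN₁ j + fN₂ j + fN₃ j + fN₄ j + 0 + fN₆ j : ℕ) = B / d := by
    rw [cN, c₂, c₃]; field_simp; ring
  have eZ2 : (fN₆ j : ℝ) / (fN₁ j + fN₂ j + fN₃ j + fN₄ j + 0 + fN₆ j : ℕ) = 1 / d := by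
    rw [cN, c₆]; field_simp
  have eX0 : ((fN₂ j : ℝ) + fN₄ j + fN₆ j) / (fN₁ j + fN₂ j + fN₃ j + fN₄ j + 0 + fN₆ j : ℕ) =
      1 - σ / d := by
    rw [cN, c₂, c₄, c₆, hσdef]; field_simp; ring
  have eX1 : ((fN₁ j : ℝ) + fN₃ j) / (fN₁ j + fN₂ j + fN₃ j + fN₄ j + 0 + fN₆ j : ℕ) = σ / d := by
    rw [cN, c₁, c₃, hσdef]; field_simp; ring
  have eX2 : ((0 : ℕ) : ℝ) / (fN₁ j + fN₂ j + fN₃ j + fN₄ j + 0 + fN₆ j : ℕ) = 0 := by simp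
  rw [eZ0, eZ1, eZ2, eX0, eX1, eX2]
  -- unfold the entropies (bits → nats)
  have hlog2 : 0 < Real.log 2 := Real.log_pos one_lt_two
  rw [shannonEntropy_def, shannonEntropy_def, div_le_div_iff_of_pos_right hlog2]
  simp only [Fin.sum_univ_three, Matrix.cons_val_zero, Matrix.cons_val_one, Matrix.cons_val_two,
    Matrix.head_cons, Matrix.tail_cons, Real.negMulLog_zero, add_zero]
  -- bounds on `σ`, `p = σ/d`
  have hσ3 : 3 ≤ σ := by
    have : (0 : ℝ) ≤ 57 / (20 * (j : ℝ)) := by positivity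
    rw [hσdef]; linarith
  set ε : ℝ := 57 / (20 * j) with hεdef
  have hε0 : 0 ≤ ε := by positivity
  have hεle : ε ≤ 57 / 1280 := by
    rw [hεdef, div_le_div_iff₀ (by positivity) (by norm_num)]; nlinarith
  have hσε : σ = 3 + ε := by rw [hσdef, hεdef]
  have hεJ : ε * j = 57 / 20 := by rw [hεdef]; field_simp
  have hσpos : 0 < σ := by linarith
  have hd65 : (2 : ℝ) ^ 65 ≤ d := hB1.trans hBd
  have hp1 : σ / d < 1 := by
    rw [div_lt_one hdpos]; linarith [hσε, hεle, hd65]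
  have hppos : 0 < σ / d := div_pos hσpos hdpos
  -- (Z) the left side in closed form
  have hZ : Real.negMulLog (2 / d) + Real.negMulLog (B / d) + Real.negMulLog (1 / d) =
      (Real.log d - Real.log B) + ((3 * (j : ℝ) + 1) * Real.log 2) / d := by
    have hlogB : Real.log B = ((j : ℝ) + 1) * Real.log 2 := by
      rw [hBdef, Real.log_pow]; push_cast; ring
    simp only [Real.negMulLog, Real.log_div two_ne_zero hdpos.ne', Real.log_div hBpos.ne' hdpos.ne',
      Real.log_div one_ne_zero hdpos.ne', Real.log_one]
    rw [hlogB]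
    have : d = B + 3 := hddef
    field_simp
    rw [this]
    ring
  -- (Z) upper bound: `log d − log B = log (d/B) ≤ d/B − 1 = 3/B`
  have hZle : Real.negMulLog (2 / d) + Real.negMulLog (B / d) + Real.negMulLog (1 / d) ≤
      3 / B + ((3 * (j : ℝ) + 1) * Real.log 2) / d := by
    rw [hZ]
    have h1 : Real.log d - Real.log B ≤ 3 / B := by
      rw [← Real.log_div hdpos.ne' hBpos.ne']
      have := Real.log_le_sub_one_of_pos (show 0 < d / B by positivity)
      have e : d / B - 1 = 3 / B := by rw [hddef]; field_simp; ring
      linarith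
    linarith
  -- (X) lower bound: `−p log p = p (log d − log σ)`, `−(1−p) log (1−p) ≥ p − p²`
  have hX1 : Real.negMulLog (σ / d) = σ / d * (Real.log d - Real.log σ) := by
    simp only [Real.negMulLog, Real.log_div hσpos.ne' hdpos.ne']; ring
  have hX0 : σ / d - (σ / d) ^ 2 ≤ Real.negMulLog (1 - σ / d) := by
    have h1p : 0 < 1 - σ / d := by linarith
    have hlog : Real.log (1 - σ / d) ≤ -(σ / d) := by
      have := Real.log_le_sub_one_of_pos h1p; linarith
    simp only [Real.negMulLog]
    linear_combination mul_le_mul_of_nonneg_left hlog h1p.le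
  -- `log d ≥ log B = (j+1) log 2`, `log σ ≤ log 3 + ε/3`
  have hlogd : ((j : ℝ) + 1) * Real.log 2 ≤ Real.log d := by
    have : Real.log B ≤ Real.log d := Real.log_le_log hBpos hBd
    rw [hBdef, Real.log_pow] at this; push_cast at this; linarith
  have hlogσ : Real.log σ ≤ Real.log 3 + ε / 3 := by
    have h := Real.log_le_sub_one_of_pos (show 0 < σ / 3 by positivity)
    rw [Real.log_div hσpos.ne' three_ne_zero] at h
    rw [hσε] at h ⊢; linarith
  have hl2 := Real.log_two_gt_d9
  have hl3 := log_three_le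
  -- the scaled inequality: `3 d/B + (3j+1) log 2 ≤ σ (log d − log σ) + σ − σ²/d`
  have key : 3 / B + ((3 * (j : ℝ) + 1) * Real.log 2) / d ≤
      σ / d * (Real.log d - Real.log σ) + (σ / d - (σ / d) ^ 2) := by
    -- lower bound for `σ (log d − log σ)`
    have hA : σ * (((j : ℝ) + 1) * Real.log 2 - Real.log 3 - ε / 3) ≤
        σ * (Real.log d - Real.log σ) := mul_le_mul_of_nonneg_left (by linarith) hσpos.le
    -- expand `σ ((j+1) log 2 − log 3 − ε/3)` using `ε j = 57/20`
    have hexp : σ * (((j : ℝ) + 1) * Real.log 2 - Real.log 3 - ε / 3) =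
        3 * ((j : ℝ) + 1) * Real.log 2 + 57 / 20 * Real.log 2 + ε * Real.log 2 - 3 * Real.log 3 -
          ε * Real.log 3 - ε - ε ^ 2 / 3 := by
      have h57 : ε * (j : ℝ) * Real.log 2 = 57 / 20 * Real.log 2 := by rw [hεJ]
      rw [hσε]; linear_combination h57
    -- numeric margin: `(97/20 + ε) log 2 − (3+ε) log 3 − ε²/3 − 19/B ≥ 0`
    have h23 : Real.log 2 ≤ Real.log 3 := Real.log_le_log two_pos (by norm_num)
    have hεML : ε * (Real.log 3 - Real.log 2) ≤ 0.018343 := by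
      have := mul_le_mul hεle (by linarith : Real.log 3 - Real.log 2 ≤ 1.10505 - 0.6931471803)
        (by linarith) (by norm_num)
      linarith
    have hε2 : ε ^ 2 / 3 ≤ 0.000662 := by
      have : ε ^ 2 ≤ (57 / 1280) ^ 2 := pow_le_pow_left₀ hε0 hεle 2
      norm_num at this; linarith
    have hB19 : 19 / B ≤ 0.000001 := by
      rw [div_le_iff₀ hBpos]; norm_num at hB1 ⊢; linarith
    have h19 : 9 / B + 10 / B = 19 / B := by ring
    have hσ2 : σ ^ 2 ≤ 10 := by nlinarith [hσε, hεle, hε0]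
    have h3dB : 3 * d / B = 3 + 9 / B := by
      rw [hddef]; field_simp; ring
    have hσd : σ ^ 2 / d ≤ 10 / B := by
      calc σ ^ 2 / d ≤ 10 / d := div_le_div_of_nonneg_right hσ2 hdpos.le
        _ ≤ 10 / B := div_le_div_of_nonneg_left (by norm_num) hBpos hBd
    -- the goal multiplied by `d`
    have hscaled : 3 * d / B + (3 * (j : ℝ) + 1) * Real.log 2 ≤
        σ * (Real.log d - Real.log σ) + σ - σ ^ 2 / d := by
      rw [h3dB]
      linarith [hA, hexp, hεML, hε2, hB19, hσd, hl2, hl3, hσε, h19]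
    have hdiv := div_le_div_of_nonneg_right hscaled hdpos.le
    have e1 : 3 / B + ((3 * (j : ℝ) + 1) * Real.log 2) / d =
        (3 * d / B + (3 * (j : ℝ) + 1) * Real.log 2) / d := by
      field_simp
    have e2 : σ / d * (Real.log d - Real.log σ) + (σ / d - (σ / d) ^ 2) =
        (σ * (Real.log d - Real.log σ) + σ - σ ^ 2 / d) / d := by
      field_simp; ring
    rw [e1, e2]; exact hdiv
  linarith [hZle, hX1, hX0, key]

/-! ## The rung from the `Y`-inequality alone -/

/-- **`TwinSaturation` from the `Y`-inequality of the STAGE-2 family alone** (any threshold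
`j₀ ≥ 64`). [cite: AlmanDuanVassilevskaWilliamsXuXuZhou2025, §3.4] -/
theorem twinSaturation_of_familyY (j₀ : ℕ) (hj₀ : 64 ≤ j₀)
    (hY : ∀ j : ℕ, j₀ ≤ j →
      shannonEntropy
          ![((fN₁ j : ℝ) + fN₄ j + (0 : ℕ)) / (fN₁ j + fN₂ j + fN₃ j + fN₄ j + 0 + fN₆ j : ℕ),
          ((fN₂ j : ℝ) + fN₃ j) / (fN₁ j + fN₂ j + fN₃ j + fN₄ j + 0 + fN₆ j : ℕ),
          (fN₆ j : ℝ) / (fN₁ j + fN₂ j + fN₃ j + fN₄ j + 0 + fN₆ j : ℕ)] ≤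
        shannonEntropy
          ![((fN₃ j : ℝ) + (0 : ℕ) + fN₆ j) / (fN₁ j + fN₂ j + fN₃ j + fN₄ j + 0 + fN₆ j : ℕ),
          ((fN₁ j : ℝ) + fN₂ j) / (fN₁ j + fN₂ j + fN₃ j + fN₄ j + 0 + fN₆ j : ℕ),
          (fN₄ j : ℝ) / (fN₁ j + fN₂ j + fN₃ j + fN₄ j + 0 + fN₆ j : ℕ)]) :
    TwinSaturation := by
  refine twinSaturation_of_certificates (fR j₀) (fun k => fT (j₀ + k)) (fun k => fR (j₀ + k))
    (fun k => one_le_fR (j₀ + k) (by omega)) (fun k => ?_) (fun s hs => ?_) ?_ (fun k => ?_)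
  · exact omegaRect_one_tw_exact (j₀ + k) (fN₁ (j₀ + k)) (fN₂ (j₀ + k)) (fN₃ (j₀ + k))
      (fN₄ (j₀ + k)) 0 (fN₆ (j₀ + k)) (by unfold fN₆; omega) (fN₁_add_fN₄ (j₀ + k) (by omega))
      (fN₂_add_fN₃ (j₀ + k) (by omega)) (by unfold fN₃; positivity)
      (familyX (j₀ + k) (by omega)) (hY (j₀ + k) (by omega))
  · obtain ⟨k, hk⟩ := exists_nat_ge (2 / (1 - s))
    refine ⟨k, ?_⟩
    have h1s : 0 < 1 - s := by linarith
    have hjpos : (0 : ℝ) < ((j₀ + k : ℕ) : ℝ) := by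
      have : (1 : ℝ) ≤ ((j₀ + k : ℕ) : ℝ) := by exact_mod_cast (by omega : 1 ≤ j₀ + k)
      linarith
    have hle := one_sub_fT_le (j₀ + k) (by omega)
    have hk' : 2 / (1 - s) ≤ ((j₀ + k : ℕ) : ℝ) := hk.trans (by push_cast; linarith [(Nat.cast_nonneg j₀ : (0:ℝ) ≤ j₀)])
    have h2 : 2 / ((j₀ + k : ℕ) : ℝ) ≤ 1 - s := by
      rw [div_le_iff₀ hjpos]
      have := (div_le_iff₀ h1s).1 hk'
      linarith
    show s ≤ fT (j₀ + k)
    linarith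
  · show fR (j₀ + 0) ≤ 3 * fR j₀
    rw [add_zero]
    linarith [one_le_fR j₀ (by omega)]
  · show fR (j₀ + (k + 1)) ≤ fR j₀ * (3 : ℝ) ^ (1 / (1 - fT (j₀ + k)))
    have h1 := fR_le (j₀ + (k + 1)) (by omega)
    have h2 := two_pow_le_three_rpow (j₀ + k)
    have h3 := four_le_fR j₀ (by omega)
    have e : (2 : ℝ) ^ (j₀ + (k + 1) + 1) = 4 * (2 : ℝ) ^ (j₀ + k) := by ring
    rw [e] at h1
    have h4 : (0 : ℝ) ≤ (2 : ℝ) ^ (j₀ + k) := by positivity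
    nlinarith [mul_le_mul h3 h2 h4 (by linarith)]

end Summit.MatrixMultiplication.MatrixMultiplication.Theorems.SaturationLadderTwinFamilyX

end
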